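import Mathlib.RingTheory.Int.Basic
import Mathlib.Data.ZMod.Basic
import Mathlib.Tactic
import HarnessLib

/-!
# Tate's algorithm at `3` in integers for `y² = x³ + Ax² + Bx + C` with `3 ∤ j`: `I₀*` or non-minimal

HONEST FRAMING (cell `b2b-bsdres`, run/shared/lean/b2b/bsd-rank1-residual/, verbatim in every
file): the goal of the cell is to DELETE the COMBINATION-SHAPED residual classes of the
Birch–Swinnerton-Dyer formula for ALL analytic-rank `≤ 1` elliptic curves over `ℚ` — "full BSD
formula for every rank `≤ 1` curve in class `C`" assembled STRICTLY from published theorems — so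
that the rank-`≤ 1` remainder becomes exactly the CONSTRUCTION-SHAPED classes, which are TYPED
(missing-input `Prop`s), NOT attempted. This is not "finishing BSD". Sub-cell `additive-p2`
(X3♯(G-ord)/X4♯(G-ord): additive `p`, potentially good ORDINARY), generation 10: research route;
no claim beyond the stated classes; theorems only, no definition, no named fact.

WHAT THIS FILE DOES. The ARITHMETIC CORE (plain integers, no curves) of the converse half of the
sub-cell's dictionary at `p = 3`: "`E` additive at `3` with `ord₃ j(E) = 0` ⟹ the twist
`E^{(−3)}` is good at `3`" (`TypeGThreeUnitJ.lean`). For a cubic model `y² = x³ + Ax² + Bx + C`,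
`A, B, C ∈ ℤ`, write `c = A² − 3B` (`= c₄`) and
`D = A²B² − 4B³ − 4A³C − 27C² + 18ABC` (`= 2⁸ Δ`), both invariant under `x ↦ x + t`
(`c_translate`, `disc_translate`). HYPOTHESES: `3 ∣ c`, `3 ∣ D` (additive reduction) and
`3^k ∣ c ⇒ 3^{3k} ∣ D` for all `k` (`ord₃ D ≥ 3 ord₃ c`, i.e. `ord₃ j ≥ 0` read with
`j = 2⁸c³/D`; with `ord₃ j = 0` exactly). CONCLUSION (`main`): after an integer translation
EITHER `3 ∥ A`, `9 ∣ B`, `27 ∣ C` (Tate's Step 6 with `P(T) = T³ + (A/3)T² + (B/9)T + C/27`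
having nonzero `T²`-coefficient mod `3` — Kodaira `I₀*`, and `(3,0,0,0) • E^{(−3)}` is then a
good model) OR `9 ∣ A`, `81 ∣ B`, `729 ∣ C` (Step 11: the model was not minimal at `3`); the
assembly `TateThree.main` is in `TateThreeIntegralStar.lean`. THIS FILE: translation
invariance (`c_translate`, `disc_translate`, `translate_translate`), the entry (`three_dvd_A`,
`three_dvd_B`, `three_dvd_translate_neg`: Steps 1–2), `round_one` (Steps 3–6: types `II, III,
IV` excluded — `I₀*` or a triple root), `round_two` + `exists_translate_round_two` (Steps 6–8:
`9 ∣ A, B, C` forces `27 ∣ B, C`, then re-centre the triple root). Only congruences modulo powers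
of `3` and the valuation constraint `ord₃ D ≥ 3 ord₃ c` are used.

References: J. Tate, *Algorithm for determining the type of a singular fiber in an elliptic
pencil*, LNM 476 (1975) §§7–8; J. H. Silverman, *ATAEC* IV.9.4 (Steps 1–11), Ex. 4.49;
A. Kraus, Manuscripta Math. 69 (1990) 353–385 (classification at `p = 3`).
-/

namespace Summit.BirchSwinnertonDyer.Rank1Residual.Additive

namespace TateThree

/-! ### Invariance of `c = A² − 3B` and `D` under `x ↦ x + t` -/

/-- `c₄`-type invariant: `(A + 3t)² − 3(B + 2At + 3t²) = A² − 3B`. [folklore] -/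
theorem c_translate (A B t : ℤ) :
    (A + 3 * t) ^ 2 - 3 * (B + 2 * A * t + 3 * t ^ 2) = A ^ 2 - 3 * B := by ring

/-- The discriminant of `x³ + Ax² + Bx + C` is invariant under `x ↦ x + t`. [folklore] -/
theorem disc_translate (A B C t : ℤ) :
    (A + 3 * t) ^ 2 * (B + 2 * A * t + 3 * t ^ 2) ^ 2 - 4 * (B + 2 * A * t + 3 * t ^ 2) ^ 3
      - 4 * (A + 3 * t) ^ 3 * (C + B * t + A * t ^ 2 + t ^ 3)
      - 27 * (C + B * t + A * t ^ 2 + t ^ 3) ^ 2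
      + 18 * (A + 3 * t) * (B + 2 * A * t + 3 * t ^ 2) * (C + B * t + A * t ^ 2 + t ^ 3) =
    A ^ 2 * B ^ 2 - 4 * B ^ 3 - 4 * A ^ 3 * C - 27 * C ^ 2 + 18 * A * B * C := by ring

/-- Two translations compose: the coefficients after `x ↦ x + t` then `x ↦ x + s` are those after
`x ↦ x + (t + s)`. [folklore] -/
theorem translate_translate (A B C t s : ℤ) :
    (A + 3 * t) + 3 * s = A + 3 * (t + s) ∧
    (B + 2 * A * t + 3 * t ^ 2) + 2 * (A + 3 * t) * s + 3 * s ^ 2 =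
      B + 2 * A * (t + s) + 3 * (t + s) ^ 2 ∧
    (C + B * t + A * t ^ 2 + t ^ 3) + (B + 2 * A * t + 3 * t ^ 2) * s + (A + 3 * t) * s ^ 2 + s ^ 3 =
      C + B * (t + s) + A * (t + s) ^ 2 + (t + s) ^ 3 :=
  ⟨by ring, by ring, by ring⟩

/-! ### Small arithmetic -/

/-- `3 ∣ m·x` with `3 ∤ m` gives `3 ∣ x`. [folklore] -/
theorem dvd_of_three_dvd_mul {m x : ℤ} (hm : ¬ (3 : ℤ) ∣ m) (h : (3 : ℤ) ∣ m * x) : (3 : ℤ) ∣ x :=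
  (Int.prime_three.dvd_or_dvd h).resolve_left hm

/-- `3 ∣ x³ ⇒ 3 ∣ x` and `3 ∣ x² ⇒ 3 ∣ x`. [folklore] -/
theorem three_dvd_of_dvd_pow {x : ℤ} {n : ℕ} (h : (3 : ℤ) ∣ x ^ n) : (3 : ℤ) ∣ x :=
  Int.prime_three.dvd_of_dvd_pow h

/-! ### Entry: additive reduction at `3` puts `3 ∣ A`, `3 ∣ B`, and after a translation `3 ∣ C` -/

/-- `3 ∣ A² − 3B ⇒ 3 ∣ A`. [folklore] -/
theorem three_dvd_A {A B : ℤ} (hc : (3 : ℤ) ∣ A ^ 2 - 3 * B) : (3 : ℤ) ∣ A := by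
  have h : (3 : ℤ) ∣ A ^ 2 := by
    have e : A ^ 2 = (A ^ 2 - 3 * B) + 3 * B := by ring
    rw [e]; exact dvd_add hc (dvd_mul_right 3 B)
  exact three_dvd_of_dvd_pow h

/-- `3 ∣ A`, `3 ∣ D ⇒ 3 ∣ B` (`D ≡ −4B³ (mod 3)`). [folklore] -/
theorem three_dvd_B {A B C : ℤ} (hA : (3 : ℤ) ∣ A)
    (hD : (3 : ℤ) ∣ A ^ 2 * B ^ 2 - 4 * B ^ 3 - 4 * A ^ 3 * C - 27 * C ^ 2 + 18 * A * B * C) :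
    (3 : ℤ) ∣ B := by
  obtain ⟨a, rfl⟩ := hA
  have h : (3 : ℤ) ∣ 4 * B ^ 3 := by
    have e : 4 * B ^ 3 = 3 * (3 * a ^ 2 * B ^ 2 - 36 * a ^ 3 * C - 9 * C ^ 2 + 18 * a * B * C) -
        ((3 * a) ^ 2 * B ^ 2 - 4 * B ^ 3 - 4 * (3 * a) ^ 3 * C - 27 * C ^ 2
          + 18 * (3 * a) * B * C) := by ring
    rw [e]; exact dvd_sub (dvd_mul_right 3 _) hD
  exact three_dvd_of_dvd_pow (dvd_of_three_dvd_mul (by norm_num) h)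

/-- With `3 ∣ A`, `3 ∣ B`, the translation `t = −C` achieves `3 ∣ C'` (the cubic mod `3` is
`(x + C)³`; Tate's Step 1/2: move the singular point to the origin). [folklore] -/
theorem three_dvd_translate_neg {A B C : ℤ} (hA : (3 : ℤ) ∣ A) (hB : (3 : ℤ) ∣ B) :
    (3 : ℤ) ∣ A + 3 * (-C) ∧ (3 : ℤ) ∣ B + 2 * A * (-C) + 3 * (-C) ^ 2 ∧
      (3 : ℤ) ∣ C + B * (-C) + A * (-C) ^ 2 + (-C) ^ 3 := by
  refine ⟨dvd_add hA (dvd_mul_right 3 _), ?_, ?_⟩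
  · exact dvd_add (dvd_add hB (by rw [mul_assoc]; exact dvd_mul_of_dvd_right (dvd_mul_of_dvd_left hA _) 2))
      (dvd_mul_right 3 _)
  · -- Fermat at `3`: `3 ∣ C³ − C` (the tree's `three_dvd_cube_sub`, inlined)
    have hF : (3 : ℤ) ∣ C ^ 3 - C := by
      have h : ((C ^ 3 - C : ℤ) : ZMod 3) = 0 := by
        push_cast
        have key : ∀ r : ZMod 3, r ^ 3 - r = 0 := by decide
        exact key _
      exact (ZMod.intCast_zmod_eq_zero_iff_dvd _ 3).mp h
    have e : C + B * (-C) + A * (-C) ^ 2 + (-C) ^ 3 = -(C ^ 3 - C) + (-(B * C) + A * C ^ 2) := by ring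
    rw [e]
    exact dvd_add (dvd_neg.mpr hF)
      (dvd_add (dvd_neg.mpr (dvd_mul_of_dvd_left hB C)) (dvd_mul_of_dvd_left hA _))

/-! ### Round one (Tate's Steps 3–6): types `II, III, IV` are excluded; `I₀*` or go on -/

/-- **Round one.** `3 ∣ A, B, C` and `3⁶ ∣ D` (i.e. `ord₃ c ≥ 2`): EITHER `3 ∥ A`, `9 ∣ B`,
`27 ∣ C` (Step 6 with `a₂,₁ ≠ 0`: Kodaira `I₀*` with the cubic `T³ + āT² + …`, `ā ≠ 0`,
separable — see `TypeGThreeUnitJ.lean`) OR `9 ∣ A, B, C` (the cubic has a triple root at `0`;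
Steps 8–10 follow). The branch `9 ∣ A, 3 ∥ C` (type `II`-like) has `ord₃ D = 5` and is killed by
`3⁶ ∣ D`; `3 ∥ B` (type `III`) by `D ≡ −4B³ (mod 27)`. [folklore] -/
theorem round_one {A B C : ℤ} (hA : (3 : ℤ) ∣ A) (hB : (3 : ℤ) ∣ B) (hC : (3 : ℤ) ∣ C)
    (hD : (3 : ℤ) ^ 6 ∣ A ^ 2 * B ^ 2 - 4 * B ^ 3 - 4 * A ^ 3 * C - 27 * C ^ 2 + 18 * A * B * C) :
    (¬ (9 : ℤ) ∣ A ∧ (9 : ℤ) ∣ B ∧ (27 : ℤ) ∣ C) ∨ ((9 : ℤ) ∣ A ∧ (9 : ℤ) ∣ B ∧ (9 : ℤ) ∣ C) := by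
  obtain ⟨a, rfl⟩ := hA
  obtain ⟨b, rfl⟩ := hB
  obtain ⟨c, rfl⟩ := hC
  -- `D = 27 X`
  have hX : (3 : ℤ) ^ 3 ∣ 3 * a ^ 2 * b ^ 2 - 4 * b ^ 3 - 12 * a ^ 3 * c - 9 * c ^ 2
      + 18 * a * b * c := by
    have e : (3 * a) ^ 2 * (3 * b) ^ 2 - 4 * (3 * b) ^ 3 - 4 * (3 * a) ^ 3 * (3 * c)
        - 27 * (3 * c) ^ 2 + 18 * (3 * a) * (3 * b) * (3 * c) =
        3 ^ 3 * (3 * a ^ 2 * b ^ 2 - 4 * b ^ 3 - 12 * a ^ 3 * c - 9 * c ^ 2 + 18 * a * b * c) := by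
      ring
    rw [show (3 : ℤ) ^ 6 = 3 ^ 3 * 3 ^ 3 by norm_num, e] at hD
    exact (mul_dvd_mul_iff_left (by norm_num)).mp hD
  -- `3 ∣ b`
  have hb : (3 : ℤ) ∣ b := by
    have h3 : (3 : ℤ) ∣ 3 * a ^ 2 * b ^ 2 - 4 * b ^ 3 - 12 * a ^ 3 * c - 9 * c ^ 2
        + 18 * a * b * c := dvd_trans ⟨9, by norm_num⟩ hX
    have h4 : (3 : ℤ) ∣ 4 * b ^ 3 := by
      have e : 4 * b ^ 3 = 3 * (a ^ 2 * b ^ 2 - 4 * a ^ 3 * c - 3 * c ^ 2 + 6 * a * b * c) -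
          (3 * a ^ 2 * b ^ 2 - 4 * b ^ 3 - 12 * a ^ 3 * c - 9 * c ^ 2 + 18 * a * b * c) := by ring
      rw [e]; exact dvd_sub (dvd_mul_right 3 _) h3
    exact three_dvd_of_dvd_pow (dvd_of_three_dvd_mul (by norm_num) h4)
  obtain ⟨b', rfl⟩ := hb
  -- `9 ∣ X ⇒ 3 ∣ a³ c`
  have h9 : (9 : ℤ) ∣ 3 * a ^ 2 * (3 * b') ^ 2 - 4 * (3 * b') ^ 3 - 12 * a ^ 3 * c - 9 * c ^ 2
      + 18 * a * (3 * b') * c := dvd_trans ⟨3, by norm_num⟩ hX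
  have hac : (3 : ℤ) ∣ a ^ 3 * c := by
    have h : (9 : ℤ) ∣ 12 * (a ^ 3 * c) := by
      have e : 12 * (a ^ 3 * c) = 9 * (3 * a ^ 2 * b' ^ 2 - 12 * b' ^ 3 - c ^ 2 + 6 * a * b' * c) -
          (3 * a ^ 2 * (3 * b') ^ 2 - 4 * (3 * b') ^ 3 - 12 * a ^ 3 * c - 9 * c ^ 2
            + 18 * a * (3 * b') * c) := by ring
      rw [e]; exact dvd_sub (dvd_mul_right 9 _) h9
    have h' : (3 : ℤ) ∣ 4 * (a ^ 3 * c) := by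
      rw [show (12 : ℤ) * (a ^ 3 * c) = 3 * (4 * (a ^ 3 * c)) by ring,
        show (9 : ℤ) = 3 * 3 by norm_num] at h
      exact (mul_dvd_mul_iff_left (by norm_num)).mp h
    exact dvd_of_three_dvd_mul (by norm_num) h'
  by_cases ha : (3 : ℤ) ∣ a
  · -- `9 ∣ A`: then `3 ∣ c` is forced (else `ord₃ D = 5`)
    obtain ⟨a', rfl⟩ := ha
    have hc : (3 : ℤ) ∣ c := by
      have h : (27 : ℤ) ∣ 9 * c ^ 2 := by
        have e : 9 * c ^ 2 = 27 * (9 * a' ^ 2 * b' ^ 2 - 4 * b' ^ 3 - 12 * a' ^ 3 * c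
            + 6 * a' * b' * c) -
            (3 * (3 * a') ^ 2 * (3 * b') ^ 2 - 4 * (3 * b') ^ 3 - 12 * (3 * a') ^ 3 * c - 9 * c ^ 2
              + 18 * (3 * a') * (3 * b') * c) := by ring
        rw [e]; exact dvd_sub (dvd_mul_right 27 _) (by simpa using hX)
      have h' : (3 : ℤ) ∣ c ^ 2 := by
        rw [show (27 : ℤ) = 9 * 3 by norm_num] at h
        exact (mul_dvd_mul_iff_left (by norm_num)).mp h
      exact three_dvd_of_dvd_pow h'
    obtain ⟨c', rfl⟩ := hc
    exact Or.inr ⟨⟨a', by ring⟩, ⟨b', by ring⟩, ⟨c', by ring⟩⟩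
  · -- `3 ∥ A`: then `3 ∣ c`, and `27 ∣ X` forces `9 ∣ c`
    have hc : (3 : ℤ) ∣ c := (Int.prime_three.dvd_or_dvd hac).resolve_left
      (fun h ↦ ha (three_dvd_of_dvd_pow h))
    obtain ⟨c', rfl⟩ := hc
    have hc' : (3 : ℤ) ∣ c' := by
      have h : (27 : ℤ) ∣ 36 * (a ^ 3 * c') := by
        have e : 36 * (a ^ 3 * c') = 27 * (a ^ 2 * b' ^ 2 - 4 * b' ^ 3 - 3 * c' ^ 2
            + 6 * a * b' * c') -
            (3 * a ^ 2 * (3 * b') ^ 2 - 4 * (3 * b') ^ 3 - 12 * a ^ 3 * (3 * c') - 9 * (3 * c') ^ 2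
              + 18 * a * (3 * b') * (3 * c')) := by ring
        rw [e]; exact dvd_sub (dvd_mul_right 27 _) (by simpa using hX)
      have h' : (3 : ℤ) ∣ 4 * (a ^ 3 * c') := by
        rw [show (36 : ℤ) * (a ^ 3 * c') = 9 * (4 * (a ^ 3 * c')) by ring,
          show (27 : ℤ) = 9 * 3 by norm_num] at h
        exact (mul_dvd_mul_iff_left (by norm_num)).mp h
      exact (Int.prime_three.dvd_or_dvd (dvd_of_three_dvd_mul (by norm_num) h')).elim
        (fun h3 ↦ absurd (three_dvd_of_dvd_pow h3) ha) id
    obtain ⟨c'', rfl⟩ := hc'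
    refine Or.inl ⟨fun h9 ↦ ha ?_, ⟨b', by ring⟩, ⟨c'', by ring⟩⟩
    rw [show (9 : ℤ) = 3 * 3 by norm_num] at h9
    exact (mul_dvd_mul_iff_left (by norm_num)).mp h9


/-! ### Round two (Steps 6–8 with a triple root): `9 ∣ A, B, C` forces `27 ∣ B, C` -/

/-- **Round two.** `9 ∣ A, B, C` and the valuation constraint `3^k ∣ c ⇒ 3^{3k} ∣ D` for
`k = 3, 4`: then `27 ∣ B` (else `27 ∥ c`, `3⁹ ∣ D` but `D = 3⁶·X`, `X ≡ −4(B/9)³ ≢ 0 (mod 3)`) and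
`27 ∣ C` (`3¹² ∣ D ⇒ 3⁶ ∣ X ≡ −3(C/9)² (mod 9)`). [folklore] -/
theorem round_two {A B C : ℤ} (hA : (9 : ℤ) ∣ A) (hB : (9 : ℤ) ∣ B) (hC : (9 : ℤ) ∣ C)
    (hcD3 : (3 : ℤ) ^ 3 ∣ A ^ 2 - 3 * B →
      (3 : ℤ) ^ 9 ∣ A ^ 2 * B ^ 2 - 4 * B ^ 3 - 4 * A ^ 3 * C - 27 * C ^ 2 + 18 * A * B * C)
    (hcD4 : (3 : ℤ) ^ 4 ∣ A ^ 2 - 3 * B →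
      (3 : ℤ) ^ 12 ∣ A ^ 2 * B ^ 2 - 4 * B ^ 3 - 4 * A ^ 3 * C - 27 * C ^ 2 + 18 * A * B * C) :
    (27 : ℤ) ∣ B ∧ (27 : ℤ) ∣ C := by
  obtain ⟨α, rfl⟩ := hA
  obtain ⟨β, rfl⟩ := hB
  obtain ⟨γ, rfl⟩ := hC
  -- `D = 3⁶ X`
  have e : (9 * α) ^ 2 * (9 * β) ^ 2 - 4 * (9 * β) ^ 3 - 4 * (9 * α) ^ 3 * (9 * γ)
      - 27 * (9 * γ) ^ 2 + 18 * (9 * α) * (9 * β) * (9 * γ) =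
      3 ^ 6 * (9 * α ^ 2 * β ^ 2 - 4 * β ^ 3 - 36 * α ^ 3 * γ - 3 * γ ^ 2 + 18 * α * β * γ) := by
    ring
  -- `3 ∣ β`
  have hβ : (3 : ℤ) ∣ β := by
    by_contra hβ
    have hc : (3 : ℤ) ^ 3 ∣ (9 * α) ^ 2 - 3 * (9 * β) := ⟨3 * α ^ 2 - β, by ring⟩
    have h9 := hcD3 hc
    rw [e, show (3 : ℤ) ^ 9 = 3 ^ 6 * 3 ^ 3 by norm_num] at h9
    have hX : (3 : ℤ) ∣ 9 * α ^ 2 * β ^ 2 - 4 * β ^ 3 - 36 * α ^ 3 * γ - 3 * γ ^ 2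
        + 18 * α * β * γ := dvd_trans ⟨9, by norm_num⟩ ((mul_dvd_mul_iff_left (by norm_num)).mp h9)
    have h4 : (3 : ℤ) ∣ 4 * β ^ 3 := by
      have e' : 4 * β ^ 3 = 3 * (3 * α ^ 2 * β ^ 2 - 12 * α ^ 3 * γ - γ ^ 2 + 6 * α * β * γ) -
          (9 * α ^ 2 * β ^ 2 - 4 * β ^ 3 - 36 * α ^ 3 * γ - 3 * γ ^ 2 + 18 * α * β * γ) := by ring
      rw [e']; exact dvd_sub (dvd_mul_right 3 _) hX
    exact hβ (three_dvd_of_dvd_pow (dvd_of_three_dvd_mul (by norm_num) h4))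
  obtain ⟨β', rfl⟩ := hβ
  refine ⟨⟨β', by ring⟩, ?_⟩
  -- `3 ∣ γ`
  have hc : (3 : ℤ) ^ 4 ∣ (9 * α) ^ 2 - 3 * (9 * (3 * β')) := ⟨α ^ 2 - β', by ring⟩
  have h12 := hcD4 hc
  rw [e, show (3 : ℤ) ^ 12 = 3 ^ 6 * 3 ^ 6 by norm_num] at h12
  have hX : (9 : ℤ) ∣ 9 * α ^ 2 * (3 * β') ^ 2 - 4 * (3 * β') ^ 3 - 36 * α ^ 3 * γ - 3 * γ ^ 2
      + 18 * α * (3 * β') * γ :=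
    dvd_trans ⟨81, by norm_num⟩ ((mul_dvd_mul_iff_left (by norm_num)).mp h12)
  have h3 : (9 : ℤ) ∣ 3 * γ ^ 2 := by
    have e' : 3 * γ ^ 2 = 9 * (9 * α ^ 2 * β' ^ 2 - 12 * β' ^ 3 - 4 * α ^ 3 * γ + 6 * α * β' * γ) -
        (9 * α ^ 2 * (3 * β') ^ 2 - 4 * (3 * β') ^ 3 - 36 * α ^ 3 * γ - 3 * γ ^ 2
          + 18 * α * (3 * β') * γ) := by ring
    rw [e']; exact dvd_sub (dvd_mul_right 9 _) hX
  have hγ : (3 : ℤ) ∣ γ := by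
    rw [show (9 : ℤ) = 3 * 3 by norm_num] at h3
    exact three_dvd_of_dvd_pow ((mul_dvd_mul_iff_left (by norm_num)).mp h3)
  obtain ⟨γ', rfl⟩ := hγ
  exact ⟨γ', by ring⟩

/-- The second translation (Step 8: the cubic `T³ + (A/3)T² + (B/9)T + C/27 ≡ (T + C/27)³` has a
triple root; move it to `0`): with `9 ∣ A`, `27 ∣ B`, `27 ∣ C`, translating by `s = −C/9` gives
`9 ∣ A'`, `27 ∣ B'`, `81 ∣ C'`. [folklore] -/
theorem exists_translate_round_two {A B C : ℤ} (hA : (9 : ℤ) ∣ A) (hB : (27 : ℤ) ∣ B)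
    (hC : (27 : ℤ) ∣ C) :
    ∃ s : ℤ, (9 : ℤ) ∣ A + 3 * s ∧ (27 : ℤ) ∣ B + 2 * A * s + 3 * s ^ 2 ∧
      (81 : ℤ) ∣ C + B * s + A * s ^ 2 + s ^ 3 := by
  obtain ⟨α, rfl⟩ := hA
  obtain ⟨β, rfl⟩ := hB
  obtain ⟨γ, rfl⟩ := hC
  refine ⟨-(3 * γ), ⟨α - γ, by ring⟩, ⟨β - 2 * α * γ + γ ^ 2, by ring⟩, ?_⟩
  have hF : (3 : ℤ) ∣ γ ^ 3 - γ := by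
    have h : ((γ ^ 3 - γ : ℤ) : ZMod 3) = 0 := by
      push_cast
      have key : ∀ r : ZMod 3, r ^ 3 - r = 0 := by decide
      exact key _
    exact (ZMod.intCast_zmod_eq_zero_iff_dvd _ 3).mp h
  obtain ⟨q, hq⟩ := hF
  refine ⟨-q + (α * γ ^ 2 - β * γ), ?_⟩
  linear_combination (-27 : ℤ) * hq

end TateThree

end Summit.BirchSwinnertonDyer.Rank1Residual.Additive
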